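import Summits.QuantumFields.YangMills.Theorems.UnitScaleTiltProp8ChartDoubleBarOneStepLog
import Literature.MathematicalPhysics.QuantumFieldTheory.Balaban1983to89.BlockAveragingEMLLinearised
import HarnessLib

/-!
# Line H (`BirthV10.stub_halvingStep`, stmt-QuantumFields-19200) — LEMMA B-al, torus half of (B-al-1): ★★ ONE DOUBLE-BAR STEP ON THE TORUS IS
# `L·(bondAvg of the bond logarithms)` TO SECOND ORDER — the straight-tube form of ✓`Prop8ChartDoubleBar.norm_mlog_dbar_sub_segMean_le`

Cell `ym3-torus` (HUMAN RULING D-0037: YM₃ on T³ is ladder rung R3 — NOT d = 4, NOT infinite volume, NOT a mass gap, NOT the Clay problem), width seat `ym-ust-19200-w3` gen 10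
(LEAD-H ★w5-19200 g7 WORD 10 (2): LEMMA B-al ≡ (N1); SIGNATURE memo 67606d20 §2 (B-al-1), §3 (3)).  `--supports stmt-QuantumFields-19200 --as helper`; THEOREMS ONLY
(0 `def`, 0 `sorry`); count-neutral; nothing here claims B-al, `H42topCrossT`, (M2′), the stub, the crux or the gap.

WHY.  (B-al-1) compares ONE averaging step of the two conventions on the same near-flat field: the `ℤᵈ` flat double bar of [Balaban1985Averaging] (89)
(`B7Prop3Flat.dbavg`, first order = `linQ` = `L^{−d}Σ_x B([x, x+Le_κ])` by lit ✓`B7Prop4Flat.prop4_flat`) and the torus double bar of [Balaban1987RG1] (0.4)∕(89)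
(`Prop8ChartDoubleBarDefs.dbarAvgU`).  The torus second-order expansion ✓`norm_mlog_dbar_sub_segMean_le` is stated with its first-order term as the RAW index mean
`|I|⁻¹ Σ_{(r,σ,σ′)} X([x_{r,σ}, x_{r,σ} + L e_μ])` over the (0.4) index set (offsets × two stair orders), the segment starting at the end of the staircase `Γ^σ(n(r))`.
THIS FILE rewrites that term as `L · (bondAvg X)(c)` — the straight tube average of [Balaban1984PropagatorsI] (1.11) (`LatticeFieldCalculus.bondAvg`), the letter in which the
dictionary to `ℤᵈ` (✓`P1FlatCoreTopBondDictionary`) and the `ℤᵈ` `linQ` are written — using lit ✓`walkEnd_emb_stairWord_eq_blockSite` (the staircases end at the block sites of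
record), ✓`walkSum_walk_replicate` (segment walk sum = `segSum`), ✓`sum_idx_of_fst`∕✓`card_idx` (the two stair orders are idle): exactly the «straight terms» step inside lit
✓`BlockAveragingEMLLinearised.linAvg_eq_bondAvg_sub_grad_combMean`, isolated as a statement.
* §1 ★ `straightMean_eq_smul_bondAvg` — `|I|⁻¹ Σ_i X(segment from x_i) = L • bondAvg X c` (matrix-valued bond fields);
* §2 ★★ `norm_mlog_dbarAvgU_sub_smul_bondAvg_le` — `‖log U̿(S)(c) − L·(bondAvg X)(c)‖ ≤ 40000·((d+2)L)²·r²` for `S = exp X`, `‖X‖ ≤ r` on the bonds of the block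
  pair `B(c₋) ∪ B(c₊)`, `200(d+2)L·r ≤ 1` (✓`norm_mlog_dbar_sub_segMean_le` ∘ §1), at `M_n(ℂ)` with the `L²`-operator norm.
HONEST SCOPE.  Bookkeeping over landed letters; the estimate is ✓`norm_mlog_dbar_sub_segMean_le`'s; nothing of B-al's comparison or induction is here.

References: T. Bałaban, CMP **98** (1985) 17–51 [Balaban1985Averaging] ((89) p.31, (122)–(125) p.36); CMP **116** (1988) [Balaban1987RG1] ((0.3)–(0.4) pp.252–253);
CMP **95** (1984) 17–40 [Balaban1984PropagatorsI] ((1.11) p.19).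
-/

set_option autoImplicit false

noncomputable section

open scoped BigOperators Matrix.Norms.L2Operator
open NormedSpace

namespace Summit.QuantumFields.YangMills.Theorems.HalvingDbarStraightMean

open Literature.MathematicalPhysics.QuantumFieldTheory.Balaban1983to89
open T4Continuum BlockAveraging AveragingRT ExpMeanLog MatrixLog LatticeFieldCalculus
open BlockAveragingEMLLinearised (walkSum walkSum_walk_replicate walkEnd_emb_stairWord_eq_blockSite sum_idx_of_fst card_idx)
open Summit.QuantumFields.YangMills.Theorems.Prop8ChartDoubleBar (dbarAvgU norm_mlog_dbar_sub_segMean_le)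

variable {P : Params} {j : ℕ} {n : Type*} [Fintype n] [DecidableEq n]

/-! ## §1 The raw index mean of the straight segments is `L · bondAvg` -/

omit [Fintype n] [DecidableEq n] in
/-- ★ **The straight terms of the (0.4) index mean are the straight tube average**: `|I|⁻¹ Σ_{(r,σ,σ′)} X([x_r, x_r + L e_μ]) = L • (bondAvg X)(c)`, `x_r = Site.blockSite c₋ r`
(the staircase `Γ^σ(n(r))` from the centre ends at `x_r`; the two stair orders are idle). [cite: Balaban1987RG1, (0.4) p.253; Balaban1984PropagatorsI, (1.11) p.19] -/
theorem straightMean_eq_smul_bondAvg (X : PBond P j → Matrix n n ℂ) (c : PBond P (j + 1)) :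
    ((Fintype.card (Idx P) : ℂ))⁻¹ • ∑ i : Idx P, walkSum X (walk (walkEnd (emb c.src) (stairWord i.2.1 (off i.1))) (List.replicate P.L (c.dir, true))) =
      ((P.L : ℕ) : ℂ) • bondAvg X c := by
  have hstraight : ∑ i : Idx P, walkSum X (walk (walkEnd (emb c.src) (stairWord i.2.1 (off i.1))) (List.replicate P.L (c.dir, true))) =
      (Fintype.card (Equiv.Perm (Fin P.d)) ^ 2) • ∑ r : Fin P.d → Fin P.L, segSum X (Site.blockSite c.src r) c.dir P.L := by
    rw [← sum_idx_of_fst]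
    refine Finset.sum_congr rfl fun i _ => ?_
    rw [walkEnd_emb_stairWord_eq_blockSite, walkSum_walk_replicate]
  have hL : (P.L : ℂ) ≠ 0 := Nat.cast_ne_zero.mpr P.L_pos.ne'
  have hS : (Fintype.card (Equiv.Perm (Fin P.d)) : ℂ) ≠ 0 := Nat.cast_ne_zero.mpr Fintype.card_pos.ne'
  rw [hstraight, bondAvg, RCLike.real_smul_eq_coe_smul (K := ℂ), smul_smul, ← Nat.cast_smul_eq_nsmul ℂ, smul_smul, card_idx]
  congr 1
  push_cast
  field_simp
  ring

/-! ## §2 One double-bar step to second order, straight-tube form -/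

variable [Nonempty n]

/-- ★★ **ONE TORUS DOUBLE-BAR STEP IS `L·bondAvg` OF THE BOND LOGARITHMS TO SECOND ORDER**: for `S = exp X` with `‖X(b)‖ ≤ r` on the bonds of `B(c₋) ∪ B(c₊)` and
`200·(d+2)L·r ≤ 1`: `‖log U̿(S)(c) − L·(bondAvg X)(c)‖ ≤ 40000·((d+2)L)²·r²` — ✓`norm_mlog_dbar_sub_segMean_le` with its first-order term read through §1.
[cite: Balaban1985Averaging, (89) p.31, (122)-(125) p.36; Balaban1987RG1, (0.4) p.253; Balaban1984PropagatorsI, (1.11) p.19] -/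
theorem norm_mlog_dbarAvgU_sub_smul_bondAvg_le (hj : j + 1 ≤ P.m + P.K) {S : GaugeField P j (Matrix n n ℂ)ˣ} {X : PBond P j → Matrix n n ℂ}
    (c : PBond P (j + 1)) {r : ℝ} (hr0 : 0 ≤ r) (hℓr : 200 * (((P.d + 2) * P.L : ℕ) : ℝ) * r ≤ 1)
    (hSX : ∀ b : PBond P j, (blockOf b.src = c.src ∨ blockOf b.src = c.tgt) → (blockOf b.tgt = c.src ∨ blockOf b.tgt = c.tgt) →
      ((S b : (Matrix n n ℂ)ˣ) : Matrix n n ℂ) = exp (X b))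
    (hX : ∀ b : PBond P j, (blockOf b.src = c.src ∨ blockOf b.src = c.tgt) → (blockOf b.tgt = c.src ∨ blockOf b.tgt = c.tgt) → ‖X b‖ ≤ r) :
    ‖mlog ((dbarAvgU S c : (Matrix n n ℂ)ˣ) : Matrix n n ℂ) - ((P.L : ℕ) : ℂ) • bondAvg X c‖ ≤ 40000 * (((P.d + 2) * P.L : ℕ) : ℝ) ^ 2 * r ^ 2 := by
  rw [← straightMean_eq_smul_bondAvg X c]
  exact norm_mlog_dbar_sub_segMean_le hj c hr0 hℓr hSX hX

end Summit.QuantumFields.YangMills.Theorems.HalvingDbarStraightMean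

end
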